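import Mathlib
import Literature.MathematicalPhysics.QuantumFieldTheory.Balaban1983to89.B10
import Literature.MathematicalPhysics.QuantumFieldTheory.Balaban1983to89.B11
import Literature.MathematicalPhysics.QuantumFieldTheory.Balaban1983to89.B13PkLocalTerms
import HarnessLib

/-!
# `Balaban1983to89.B10SectAStatements` — T. Bałaban, *Ultraviolet stability of three-dimensional lattice pure gauge
field theories*, Commun. Math. Phys. **102** (1985) 255–275 [Balaban1985UV3]: the two Sect. A statements (12) (the
first-step variational problem and its unique regular critical configuration, pp. 258–259) and (17) (the linearizing
correction `D̃`, p. 260)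

statement-level skeleton of published theorems with citation tags; proofs where landed; nothing here is a claim about
the Yang–Mills mass gap

PDF held: `paper:balaban1985-cmp102-uv-stability-3d` (journal page = PDF page + 254); renders
`run/shared/lean/pub/pub-balaban/b2b-balaban-ref1/pages/1985-cmp102-uv-stability-3d/…-p004-x2.png` (p. 258),
`…-p005-x2.png` (p. 259), `…-p006-x2.png` (p. 260).

CITATION HEADER.  WHAT IS REPRODUCED: SKELETON rows `B10.Eq12` and `B10.Eq17` of the mega-formalization `lit-balaban`
(`run/shared/lean/pub/lit-balaban/SKELETON.md` §B10; requested by the NE-spine interface, `INTERFACES.md` §1.3/§3,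
entry F-T4-190 «the first renormalization step in d = 3» → `B10.Eq12`, and F-T4-150 → `B10.Eq17-18`):
* `Eq12` — p. 258–259: *"We fix a configuration U = V₀ on Ω₁ᶜ and we look for critical points of the functional
  U → A(U) for U : U = V₀ on Ω₁ᶜ, Ū = V on Ω₁^{(1)}, U satisfies axial gauge conditions on Ω₁. (12)  For g₀ sufficiently
  small 2L²g₀p(g₀) < a₁, where a₁ is the constant in Theorem 1 [7], hence there exists the exactly one critical
  configuration U₁ in a space of regular configurations satisfying the conditions in (12). Such a space contains the
  region of integration, so there is at most one critical point in the region. … The configuration U₁ satisfies the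
  regularity conditions |U₁(∂p) − 1| < 2B₃g₀p(g₀) on Ω₁"* — typed over the EXISTING carrier of [7] =
  [Balaban1985Variational], `B11.VarProblem` (its `Bdry`/`InB` = the constraints "U = V₀ on Ω₁ᶜ, Ū = V on Ω₁^{(1)}"
  read as 𝔅-data with Λ₀ = Ω₁ᶜ, its `Reg7` = hypothesis (7) of [7], here with ε₁ = 2L²g₀p(g₀) supplied by
  Proposition 1 of [4] (p. 258; cell edge `B10.edge_B7Prop1_twoLsq`)), extended by the B10-specific predicates that
  [7]'s orbit language does not carry (axial gauge, criticality of a CONFIGURATION, the region of integration of (10),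
  the plaquette deviations on Ω₁) — structure `FirstStep`; `p(g)` = `B10.pFun`.
* `Eq17` — p. 259–260: *"we are looking for a function D̃(A, b, c) satisfying the equation Q(A − D̃(A, c), c) =
  (QA)(c) − QD̃(A, c) + C(A − D̃(A, c), c) = (QA)(c), (17) or QD̃(A, c) = C(A − D̃(A, c), c). … We assume that
  D̃(A, b, c) = 0 for all b ≠ b₀(c). … There exists a unique solution D̃ of this equation for A sufficiently small, and
  it is an analytic function of A with a Taylor expansion beginning with second order terms."* — typed over the
  EXISTING fixed-point vocabulary `B13PkLocalTerms.fpMap b₀ h Ct` (the map `D ↦ C̃(A − hD)` of [Balaban1987RG1]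
  p. 267, already used for B10's (20) in `B10Eq20Locality.eq20_of_fixedPt`, whose inputs `hfix`/`huniq` are exactly
  the existence/uniqueness half of `Eq17`).
Both are `def … : Prop` HYPOTHESES downstream (proof deferred: [7] Thm 1 + axial gauge fixing, resp. "Sect. E in
[6], Sect. C in [7]"); nothing of the series is asserted; no bookkeeping implication is typed as a decl.
NOT HERE: (13)–(16), (18)–(19) (proof narrative inside the leaf `B10SectAGathering.Bound55`, k = 0); the objects
themselves (Phase 2 instantiates `B11.VarProblem` / `fpMap` concretely).  Unit `lit-balaban-r07`; rows in
`run/shared/lean/pub/lit-balaban/lit-balaban-r07/ROWS-B10.md`.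
-/

namespace Literature.MathematicalPhysics.QuantumFieldTheory.Balaban1983to89.B10SectAStatements

/-! ## (12): the first-step variational problem -/

/-- The objects of pp. 258–259 [4–5] around **(12)**, over the variational-problem carrier of [7]: `P : B11.VarProblem`
(k = 1; `P.Bdry` = the data (V₀ on Ω₁ᶜ, V on Ω₁^{(1)}); `P.InB W U` = *"U = V₀ on Ω₁ᶜ, Ū = V on Ω₁^{(1)}"*; `P.Reg7 ε₁ W`
= hypothesis (7) of [7], *"|V(∂p′) − 1| < 2L²g₀p(g₀) on Ω₀^{(1)}"* when ε₁ = 2L²g₀p(g₀)); plus the predicates print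
uses that the orbit language of [7] does not carry: `Axial U` = *"U satisfies axial gauge conditions on Ω₁"* ((9),
(12)); `IsCritical W U` = U is a critical point of *"the functional U → A(U)"* on the constraint set of (12);
`Regular U` = U lies in *"a space of regular configurations"* (the space (6) of [7]); `InRegion W U` = U lies in the
region of integration of the Ω₁-term of (10) (*"If a configuration U belongs to this region, then it satisfies the
regularity conditions |U(∂p) − 1| < g₀p(g₀) on the domain Ω₀"*); `Plaq`, `omega1` = the plaquettes p ⊂ Ω₁ and
`dev U p` = |U(∂p) − 1|; constants `g₀` (= gε^{1/2}), `b₀`, `p₀` of (7) (`p(g) = B10.pFun b₀ p₀ g`), `L`, and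
`a₁`, `B₃` = *"the constant(s) in Theorem 1 [7]"*.  Only NAMES; nothing is constructed. [cite: Balaban1985UV3, (12) pp.258–259] -/
structure FirstStep where
  P : B11.VarProblem
  Axial : P.Cfg → Prop
  IsCritical : P.Bdry → P.Cfg → Prop
  Regular : P.Cfg → Prop
  InRegion : P.Bdry → P.Cfg → Prop
  Plaq : Type
  omega1 : Set Plaq
  dev : P.Cfg → Plaq → ℝ
  g₀ : ℝ
  b₀ : ℝ
  p₀ : ℝ
  L : ℝ
  a₁ : ℝ
  B₃ : ℝ

/-- `ε₁ = 2L²g₀p(g₀)` — the regularity parameter of the averaged field V = Ū on Ω₀^{(1)} (p. 258 [4]: *"by Proposition 1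
from [4] the configuration V = Ū satisfies the conditions |V(∂p′) − 1| < 2L²g₀p(g₀) on Ω₀^{(1)}"*). A definition with
body. [cite: Balaban1985UV3, (12) p.258] -/
noncomputable def FirstStep.eps1 (S : FirstStep) : ℝ :=
  2 * S.L ^ 2 * S.g₀ * B10.pFun S.b₀ S.p₀ S.g₀

/-- **(12)** pp. 258–259 [4–5], verbatim: *"We fix a configuration U = V₀ on Ω₁ᶜ and we look for critical points of the
functional U → A(U) for U : U = V₀ on Ω₁ᶜ, Ū = V on Ω₁^{(1)}, U satisfies axial gauge conditions on Ω₁. (12)  For g₀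
sufficiently small 2L²g₀p(g₀) < a₁, where a₁ is the constant in Theorem 1 [7], hence there exists the exactly one
critical configuration U₁ in a space of regular configurations satisfying the conditions in (12). Such a space
contains the region of integration, so there is at most one critical point in the region. We make a change of
variables in the integral over Ω₁ taking U = U′U₁. The new variables U′ are called fluctuation fields, and the
minimal configuration U₁ is called a background field. The configuration U₁ satisfies the regularity conditions
|U₁(∂p) − 1| < 2B₃g₀p(g₀) on Ω₁"* — typed reading: IF 2L²g₀p(g₀) < a₁ THEN for every boundary datum W = (V₀, V) with
the regularity (7)_{ε₁ = 2L²g₀p(g₀)} (i) there is exactly one U₁ that is regular, axial, satisfies the constraints of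
(12) and is critical, (ii) the region of integration is contained in the regular space, (iii) that U₁ has
|U₁(∂p) − 1| < 2B₃g₀p(g₀) for p ⊂ Ω₁.  Carrier clauses: the constraint set and (7) live in `B11.VarProblem`
(`InB`, `Reg7`); a₁, B₃ are [7] Thm 1's constants (edge `B11.Thm1Printed`), named here, not re-quantified.
Hypothesis-shaped leaf (proof in print: Theorem 1 of [7] + axial gauge fixing). [cite: Balaban1985UV3, (12) pp.258–259] -/
def Eq12 (S : FirstStep) : Prop :=
  S.eps1 < S.a₁ →
    ∀ W : S.P.Bdry, S.P.Reg7 S.eps1 W →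
      (∃ U₁ : S.P.Cfg, (S.Regular U₁ ∧ S.Axial U₁ ∧ S.P.InB W U₁ ∧ S.IsCritical W U₁) ∧
          ∀ U : S.P.Cfg, S.Regular U → S.Axial U → S.P.InB W U → S.IsCritical W U → U = U₁) ∧
      (∀ U : S.P.Cfg, S.InRegion W U → S.Regular U) ∧
      (∀ U₁ : S.P.Cfg, S.Regular U₁ → S.Axial U₁ → S.P.InB W U₁ → S.IsCritical W U₁ →
          ∀ p ∈ S.omega1, S.dev U₁ p < 2 * S.B₃ * S.g₀ * B10.pFun S.b₀ S.p₀ S.g₀)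

/-! ## (17): the linearizing correction `D̃` -/

section Eq17

variable {β C X : Type*} [Fintype β] [Fintype C] [NormedAddCommGroup X]

/-- **(17)** pp. 259–260 [5–6], verbatim: *"To write the integrals (13) as Gaussian integrals with small and local
interactions we have to change variables in order to linearize the functions Q(A′, c). It is possible to do it
separately for each function Q(A′, c), so the whole transformation will have good locality properties. Thus we are
looking for a function D̃(A, b, c) satisfying the equation Q(A − D̃(A, c), c) = (QA)(c) − QD̃(A, c) + C(A − D̃(A, c), c)
= (QA)(c), (17) or QD̃(A, c) = C(A − D̃(A, c), c). Let us denote by b₀(c) the bond b ∈ B(c) and contained in c … We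
assume that D̃(A, b, c) = 0 for all b ≠ b₀(c). This assures the locality properties. We have analyzed the equations of
the type (17) several times already, see Sect. E in [6], Sect. C in [7]. There exists a unique solution D̃ of this
equation for A sufficiently small, and it is an analytic function of A with a Taylor expansion beginning with second
order terms."* — typed over the fixed-point form of the cell (`B13PkLocalTerms.fpMap b₀ h Ct A : (C → X) → (C → X)`,
`D ↦ C̃(A − hD)`, with `hOp` placing `h(c)·D(c)` at the bond `b₀(c)` — the printed support assumption — and `Ct` =
the non-linear part C of (15)): on the ball `‖A‖ < r` (i) the fixed point exists and is unique, (ii) the solution map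
`Dt` is analytic (over `𝕜`; print: analytic), (iii) it vanishes to second order at A = 0 (`Dt 0 = 0`, zero Fréchet
derivative at 0).  `r > 0` = *"for A sufficiently small"*, displayed as a binder.  Hypothesis-shaped leaf (proof in
print: "Sect. E in [6], Sect. C in [7]" = [Balaban1985RegularSpaces] §E, [Balaban1985Variational] §C); its clauses
(i) are the inputs `hfix`/`huniq` of `B10Eq20Locality.eq20_of_fixedPt`.  The scalar field `𝕜` (ℝ or ℂ) is an
explicit argument. [cite: Balaban1985UV3, (17) pp.259–260] -/
def Eq17 (𝕜 : Type*) [NontriviallyNormedField 𝕜] [NormedSpace 𝕜 X] (b₀ : C → β) (h : C → X → X) (Ct : (β → X) → C → X) (r : ℝ) (Dt : (β → X) → (C → X)) : Prop :=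
  0 < r ∧
    (∀ A : β → X, ‖A‖ < r →
      Function.IsFixedPt (B13PkLocalTerms.fpMap b₀ h Ct A) (Dt A) ∧
        ∀ D : C → X, Function.IsFixedPt (B13PkLocalTerms.fpMap b₀ h Ct A) D → D = Dt A) ∧
    AnalyticOn 𝕜 Dt (Metric.ball 0 r) ∧
    Dt 0 = 0 ∧ HasFDerivAt Dt (0 : (β → X) →L[𝕜] (C → X)) 0

end Eq17

end Literature.MathematicalPhysics.QuantumFieldTheory.Balaban1983to89.B10SectAStatements
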